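import Summits.HodgeConjecture.HodgeConjecture.Theorems.EightfoldBlochSeedsChernCharacterOnBettiAnalytificationPullback
import HarnessLib

/-!
# K1 (analytification bridge), step K1e (sequel): the Betti Chern classes / character of `g^*F` are `g(ℂ)^*` of those of `F`

Route `EightfoldBlochSeeds` / item `stmt-HodgeConjecture-19780` (`ChernCharacterOnBetti`), helper
(`--supports`). HONEST FRAMING: nothing here proves 19780 / 18880 / 18882 / 18883 / H2 / HC_AV / HC;
no definition, no named fact.

From `exists_iso_pullback_of_comparison` (`g(ℂ)^*E ≅ E'` for data `(E, α)` of `F` and `(E', α')` of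
`g^*F`) and axiom (C₁) (`theChernClassTheory.chernClass_pullback`, `topologicalChernCharacter_pullback`):

* `chernClassZ_pullback_of_comparison` — `cᵢ(E') = g(ℂ)^* cᵢ(E)` in `H²ⁱ(Y(ℂ); ℤ)`;
* `topologicalChernCharacter_pullback_of_comparison` — `complexBetti.map g (2k) (ch_k(E)) = ch_k(E')`,
  the shape of the field `map_ch` of `ChernCharacterBetti` (`X`, `Y` smooth projective).

[cite: HusemollerFibreBundles1994, Ch. 17 §3 (C₁)] [cite: Hirzebruch1966, §10.1] [cite: SerreGAGA1956, §3 n°11]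
-/

noncomputable section

-- single-problem summit (Problem = Summit): the mandated namespace repeats `HodgeConjecture`.
set_option linter.dupNamespace false

open CategoryTheory AlgebraicGeometry Bundle Topology TopologicalSpace
open Literature.AlgebraicGeometry.Motives Literature.AlgebraicGeometry.HodgeTheory Literature.AlgebraicGeometry.Modules
open Literature.AlgebraicTopology.SingularHomology Literature.AlgebraicTopology.CharacteristicClasses

namespace Summit.HodgeConjecture.HodgeConjecture.Theorems

variable {n m : ℕ} {X Y : SchemeOver ℂ} (g : Y ⟶ X) {F : X.left.Modules} {r : ℕ}

section Chern

variable (hX : IsSmoothProjective n X) (hY : IsSmoothProjective m Y)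
    (hF : ∀ x : X.left, ∃ (U : X.left.Opens) (_ : SheafOfModules.free (Fin r) ≅ F.over U), x ∈ U)
    (E : ComplexVectorBundle.{0, 0} (ComplexPoints X)) (E' : ComplexVectorBundle.{0, 0} (ComplexPoints Y))
    (α : ∀ U : X.left.Opens, Γ(F, U) → ∀ P : ComplexPoints X, E.E P)
    (β : ∀ U' : Y.left.Opens, Γ((Scheme.Modules.pullback g.left).obj F, U') → ∀ Q : ComplexPoints Y, E'.E Q)
    (hadd : ∀ (U : X.left.Opens) (σ τ : Γ(F, U)) (P : ComplexPoints X), α U (σ + τ) P = α U σ P + α U τ P)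
    (hsmul : ∀ (U : X.left.Opens) (f : Γ(X.left, U)) (σ : Γ(F, U)) (P : ComplexPoints X) (h : P.pt ∈ U),
      α U (f • σ) P = P.eval U h f • α U σ P)
    (hres : ∀ (U W : X.left.Opens) (hWU : W ≤ U) (σ : Γ(F, U)) (P : ComplexPoints X), P.pt ∈ W →
      α W (F.presheaf.map (homOfLE hWU).op σ) P = α U σ P)
    (hcont : ∀ (U : X.left.Opens) (σ : Γ(F, U)),
      ContinuousOn (fun P ↦ (⟨P, α U σ P⟩ : TotalSpace E.F E.E)) {P | P.pt ∈ U})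
    (hframe : ∀ (U : X.left.Opens) (t : Fin r → Γ(F, U)), IsSectionFrame F U t →
      ∀ P : ComplexPoints X, P.pt ∈ U → LinearIndependent ℂ (fun j ↦ α U (t j) P) ∧
        ⊤ ≤ Submodule.span ℂ (Set.range fun j ↦ α U (t j) P))
    (hadd' : ∀ (U : Y.left.Opens) (σ τ : Γ((Scheme.Modules.pullback g.left).obj F, U)) (Q : ComplexPoints Y),
      β U (σ + τ) Q = β U σ Q + β U τ Q)
    (hsmul' : ∀ (U : Y.left.Opens) (f : Γ(Y.left, U)) (σ : Γ((Scheme.Modules.pullback g.left).obj F, U))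
      (Q : ComplexPoints Y) (h : Q.pt ∈ U), β U (f • σ) Q = Q.eval U h f • β U σ Q)
    (hres' : ∀ (U W : Y.left.Opens) (hWU : W ≤ U) (σ : Γ((Scheme.Modules.pullback g.left).obj F, U))
      (Q : ComplexPoints Y), Q.pt ∈ W →
      β W (((Scheme.Modules.pullback g.left).obj F).presheaf.map (homOfLE hWU).op σ) Q = β U σ Q)
    (hcont' : ∀ (U : Y.left.Opens) (σ : Γ((Scheme.Modules.pullback g.left).obj F, U)),
      ContinuousOn (fun Q ↦ (⟨Q, β U σ Q⟩ : TotalSpace E'.F E'.E)) {Q | Q.pt ∈ U})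
    (hframe' : ∀ (U : Y.left.Opens) (t : Fin r → Γ((Scheme.Modules.pullback g.left).obj F, U)),
      IsSectionFrame ((Scheme.Modules.pullback g.left).obj F) U t →
      ∀ Q : ComplexPoints Y, Q.pt ∈ U → LinearIndependent ℂ (fun j ↦ β U (t j) Q) ∧
        ⊤ ≤ Submodule.span ℂ (Set.range fun j ↦ β U (t j) Q))
include hX hY hF hadd hsmul hres hcont hframe hadd' hsmul' hres' hcont' hframe'

/-- **The integral Betti Chern classes of `g^*F` are `g(ℂ)^*` of those of `F`** ((C₁) for the
isomorphism `g(ℂ)^*E ≅ E'`; `X`, `Y` smooth projective). [cite: HusemollerFibreBundles1994, Ch. 17 §3 (C₁)]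
[cite: SerreGAGA1956, §3 n°11] -/
theorem chernClassZ_pullback_of_comparison (i : ℕ) :
    chernClassZ E' i = singularCohomology.map ℤ ℤ (AlgPoints.mapContinuous g) (2 * i) (chernClassZ E i) := by
  haveI := ComplexPoints.t2Space_of_isSmoothProjective hX
  haveI := paracompactSpace_complexPoints_of_isSmoothProjective hX
  haveI := ComplexPoints.t2Space_of_isSmoothProjective hY
  haveI := paracompactSpace_complexPoints_of_isSmoothProjective hY
  obtain ⟨e, -⟩ := exists_iso_pullback_of_comparison g hF E E' α β hadd hsmul hres hcont hframe
    hadd' hsmul' hres' hcont' hframe'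
  change theChernClassTheory.chernClass E' i =
    singularCohomology.map ℤ ℤ (AlgPoints.mapContinuous g) (2 * i) (theChernClassTheory.chernClass E i)
  rw [← theChernClassTheory.chernClass_congr e i]
  exact theChernClassTheory.chernClass_pullback (AlgPoints.mapContinuous g) E i

/-- **`map_ch`: the Betti Chern character of `g^*F` is `g(ℂ)^*` of that of `F`**:
`complexBetti.map g (2k) (ch_k(E)) = ch_k(E')` for data `(E, α)` of `F` and `(E', α')` of `g^*F`
(`X`, `Y` smooth projective). [cite: Hirzebruch1966, §10.1] [cite: HusemollerFibreBundles1994, Ch. 17 §3 (C₁)]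
[cite: SerreGAGA1956, §3 n°11] -/
theorem topologicalChernCharacter_pullback_of_comparison (k : ℕ) :
    complexBetti.map g (2 * k) (theChernClassTheory.topologicalChernCharacter ℂ E k) =
      theChernClassTheory.topologicalChernCharacter ℂ E' k := by
  haveI := ComplexPoints.t2Space_of_isSmoothProjective hX
  haveI := paracompactSpace_complexPoints_of_isSmoothProjective hX
  haveI := ComplexPoints.t2Space_of_isSmoothProjective hY
  haveI := paracompactSpace_complexPoints_of_isSmoothProjective hY
  rcases isEmpty_or_nonempty (ComplexPoints Y) with hB | hB
  · exact (ModuleCat.eq_zero_of_isZero_obj (isZero_singularCohomology_of_isEmpty' ℂ (ComplexPoints Y) (2 * k)) _).trans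
      (ModuleCat.eq_zero_of_isZero_obj (isZero_singularCohomology_of_isEmpty' ℂ (ComplexPoints Y) (2 * k)) _).symm
  obtain ⟨e, -⟩ := exists_iso_pullback_of_comparison g hF E E' α β hadd hsmul hres hcont hframe
    hadd' hsmul' hres' hcont' hframe'
  rw [← theChernClassTheory.topologicalChernCharacter_congr ℂ e (ComplexVectorBundle.Iso.rank_eq e) k,
    theChernClassTheory.topologicalChernCharacter_pullback]

end Chern

end Summit.HodgeConjecture.HodgeConjecture.Theorems

end
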